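import Literature.Analysis.Fourier.GradientBoundLpMultiplier
import Literature.Analysis.Fourier.LocalizedPhaseFamilyLinearEigenvalues
import Literature.Barriers.AtomisticToContinuum.NoBVEstimatesMultiDLinearStepProofs
import Literature.Barriers.AtomisticToContinuum.NoBVEstimatesMultiDLinearStepAssembly
import HarnessLib

/-!
# Rauch's linear step with zeroth-order term at a single time

`NoBVEstimatesMultiD.lean` vendors Rauch's Theorem as the named fact `NoBVEstimatesMultiDBarrier`
for systems (1) `A₀(u)∂ₜu + Σ Aⱼ(u)∂ⱼu + B(u) = 0` with `B(ū) = 0` and `B′(ū)` ARBITRARY, and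
records (`scope_caveats` (e)) that the last step of the printed proof — "we now appeal to the
result of Brenner [1, 2] which states that (3) is a necessary and sufficient condition for `M` to
be an `Lᵖ` multiplier for some `1 < p < ∞`, `p ≠ 2`" [Rauch1986, p. 483], applied to the single
multiplier `M(ξ) = exp(t̄A₀⁻¹(-Σ A_l iξ_l - B′(ū)))` at the one time `t̄` — is covered by
Brenner's theorems only when `B′(ū) = 0`: with lower-order terms Brenner assumes the bound for
all `0 < t ≤ T` [Brenner1973, (5.4) p. 92, Thm 5.1 p. 93] and removes them by `t → 0`
[Brenner1973, Lemma 5.2 p. 97], while dilation of the single time `t̄` only produces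
`exp(-inK(ξ) - E)`, `E = t̄A₀⁻¹B′(ū)` fixed (`rauchSymbol_smul`,
`NoBVEstimatesMultiDLinearStepReduction.lean`). Accordingly the tree split Rauch's linear step
into facts WITHOUT zeroth-order term (`Rauch1986_LpMultiplier_forces_commutation`, proved in
`NoBVEstimatesMultiDLinearStepProofs.lean`; `Rauch1986_L1GradientEstimate_imp_LpMultiplier`) and
left the case `B₁ ≠ 0` of `Rauch1986_linearL1EstimateForcesCommutation` unassembled.

This file PROVES the single-time statement with zeroth-order term
(`commute_of_isLpMultiplier_rauchSymbol`): if `rauchSymbol A₀ A B₁ T ∈ M_p` for some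
`1 ≤ p ≤ ∞`, `p ≠ 2`, `T > 0`, and the constant-coefficient system is in Rauch's class, then the
`A₀⁻¹Aⱼ` commute. The lower-order term is removed at the single time by FIRST-ORDER AVERAGING of
the dilates: near a point of smooth spectral decomposition `K(ξ) = Σ μ_b(ξ)Π_b(ξ)` one has
`exp(-inK(ξ) - E)Πₐ(ξ) = e^{-inμₐ(ξ)}(exp(-E_d(ξ))Πₐ(ξ) + O(1/n))`, `E_d = Σ Π_bEΠ_b`
(`Literature.Analysis.ODE.norm_exp_phase_add_mul_idem_sub_le`), an approximate phase relation
under which the rescaling argument of [BrennerThomeeWahlbin1975, Ch. 5 §1, proof of Lemma 1.1]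
still runs (`Literature.Analysis.Fourier.hasLinearEigenvalues_of_localizedFamily`,
`Literature.Analysis.Fourier.false_of_localizedFamily_of_strictlyHyperbolic`,
`LocalizedPhaseFamilyLinearEigenvalues.lean`); the branch and conjugation bookkeeping is that of
`NoBVEstimatesMultiDLinearStepProofs.lean`. No printed source for this single-time argument is
known to us; it is recorded as the proof of a [folklore]-expected statement (cf.
`NoBVEstimatesMultiD.lean`, `scope_caveats` (e), where a different repair via `Lᵖ` bounds for
Fourier integral operators is sketched) and every step is checked here.

Consequences (`Rauch1986_linearL1EstimateForcesCommutation_of_interpolation`,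
`NoBVEstimatesMultiDBarrier_of_expansion_propagation_interpolation`): the named fact
`Rauch1986_linearL1EstimateForcesCommutation` WITH zeroth-order term follows from the
interpolation of homogeneous Sobolev bounds (`gradientLpBound_interpolation`) and finite speed of
propagation for Rauch's class (`Rauch1986_finitePropagationSpeed`), and Rauch's theorem
`NoBVEstimatesMultiDBarrier` in full generality (`B′(ū)` arbitrary) follows from these two and the
`L²` small-amplitude expansion (`Rauch1986_smallAmplitudeExpansionL2`) — with no unprinted step
left in its cone.

## References

* [Rauch1986] J. Rauch, Comm. Math. Phys. 106 (1986) 481–484: Theorem p. 482, Proof of Theorem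
  p. 483 (last sentence), (5)–(6).
* [Brenner1973] P. Brenner, Ark. Mat. 11 (1973) 75–101: Thm 3.1 and Cor 3.1 p. 84, (5.4) p. 92,
  Thm 5.1 p. 93, Lemma 5.2 p. 97.
* [BrennerThomeeWahlbin1975] P. Brenner, V. Thomée, L. B. Wahlbin, LNM 434 (1975), Ch. 1
  Thm 2.8; Ch. 5 §1 Thm 1.1, Lemmas 1.1–1.2.
* [Badr2009] N. Badr, Math. Scand. 105 (2009) 235–264, Thm 1.4, Cor 5.9 (the interpolation
  input, via `SobolevMultiplierBound.lean`).
-/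

noncomputable section

open MeasureTheory Complex Real Filter Topology Set Metric Polynomial NormedSpace
open scoped ENNReal NNReal ContDiff Matrix

namespace Literature.Barriers.AtomisticToContinuum

open Literature.Analysis.Fourier Literature.Analysis.Matrix Literature.Analysis.ODE
  Literature.LinearAlgebra.Matrix QuasilinearSystem

variable {d k : ℕ}

/-! ### Phase symbols with zeroth-order term as exponentials of the complexified pencil -/

/-- `exp(Σ (-inξ_l)K_l + E) = exp(in · pencil(-K)(ξ) + E)`: Rauch's phase symbol WITH
zeroth-order term as the exponential of `((n·1) i)` times the pencil of the matrices `-K_l ⊗ ℂ`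
plus the complexified zeroth-order matrix. [cite: Rauch1986, Proof of Theorem p. 483] -/
theorem rauchPhaseSymbol_eq_exp_pencil (K : Fin d → Matrix (Fin k) (Fin k) ℝ)
    (E : Matrix (Fin k) (Fin k) ℝ) (n : ℝ) (ξ : Space d) :
    rauchPhaseSymbol K E n ξ =
      NormedSpace.exp ((((n * 1 : ℝ) : ℂ) * I) • pencil (fun j => (-K j).map (algebraMap ℝ ℂ)) ξ +
        E.map (algebraMap ℝ ℂ)) := by
  unfold rauchPhaseSymbol pencil
  congr 2
  rw [Finset.smul_sum]
  refine Finset.sum_congr rfl fun l _ => ?_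
  dsimp only
  rw [Matrix.map_neg _ (map_neg (algebraMap ℝ ℂ)), smul_neg, smul_neg, smul_smul, ← neg_smul]
  congr 1
  push_cast
  ring

/-- A uniform phase family with zeroth-order term is, in particular, a localized family (cut-off
`θ = 1`) of the symbols `exp(i(n+1) pencil(-K)(ξ) + E)`, `n = 0, 1, …`. [folklore] -/
theorem localizedFamily_of_uniformPhaseFamily {p : ℝ≥0∞} {K : Fin d → Matrix (Fin k) (Fin k) ℝ}
    {E : Matrix (Fin k) (Fin k) ℝ} (h : UniformPhaseFamily p K E) (ξ₁ : EuclideanSpace ℝ (Fin d)) :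
    ∃ (θ : EuclideanSpace ℝ (Fin d) → ℝ) (C : ℝ≥0), (∀ᶠ ξ in 𝓝 ξ₁, θ ξ = 1) ∧
      ∀ n : ℕ, IsLpMultiplierWith p C (fun ξ => ((θ ξ : ℝ) : ℂ) •
        NormedSpace.exp ((((((n : ℝ) + 1) * 1 : ℝ) : ℂ) * I) •
          pencil (fun j => (-K j).map (algebraMap ℝ ℂ)) ξ + E.map (algebraMap ℝ ℂ))) := by
  obtain ⟨C, hC⟩ := h
  refine ⟨fun _ => 1, C, Eventually.of_forall fun _ => rfl, fun n => ?_⟩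
  have h1 := hC ((n : ℝ) + 1) (by positivity)
  have heq : rauchPhaseSymbol K E ((n : ℝ) + 1) = fun ξ : EuclideanSpace ℝ (Fin d) =>
      (((1 : ℝ) : ℝ) : ℂ) • NormedSpace.exp ((((((n : ℝ) + 1) * 1 : ℝ) : ℂ) * I) •
        pencil (fun j => (-K j).map (algebraMap ℝ ℂ)) ξ + E.map (algebraMap ℝ ℂ)) := by
    funext ξ
    rw [rauchPhaseSymbol_eq_exp_pencil K E _ ξ, Complex.ofReal_one, one_smul]
  rwa [heq] at h1

/-! ### Symmetric pencils: a uniform family with zeroth-order term forces commutation -/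

/-- **Symmetric pencils with a uniform phase family, zeroth-order term included, commute**: if
the `K_l` are real symmetric, `E` is any real matrix, `1 ≤ p ≤ ∞`, `p ≠ 2`, and the phase symbols
`exp(-inK(ξ) + E)`, `n ≠ 0`, are in `M_p` with one constant, then the `K_l` commute (Lemma 1.1
with zeroth-order term, `hasLinearEigenvalues_of_localizedFamily`, and Lemma 1.2,
`HasLinearEigenvalues.commute`).
[cite: BrennerThomeeWahlbin1975, Ch. 5 §1 Thm 1.1, Lemmas 1.1–1.2; Rauch1986, Proof of Theorem
p. 483 (last sentence)] -/
theorem commute_of_uniformPhaseFamily_symmetric_zeroth {p : ℝ≥0∞} (hp1 : 1 ≤ p) (hp2 : p ≠ 2)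
    {K : Fin d → Matrix (Fin k) (Fin k) ℝ} (hK : ∀ j, (K j).IsSymm) {E : Matrix (Fin k) (Fin k) ℝ}
    (h : UniformPhaseFamily p K E) (j l : Fin d) : Commute (K j) (K l) := by
  set A : Fin d → Matrix (Fin k) (Fin k) ℂ := fun j => (-K j).map (algebraMap ℝ ℂ) with hA
  have hAh : ∀ j, (A j).IsHermitian := fun j => isHermitian_map_of_isSymm (hK j).neg
  have hlin : HasLinearEigenvalues A :=
    hasLinearEigenvalues_of_localizedFamily hAh hp1 hp2 (s := 1) one_ne_zero
      (E.map (algebraMap ℝ ℂ)) fun ξ₁ _ => localizedFamily_of_uniformPhaseFamily h ξ₁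
  have hcomm : Commute (A j) (A l) := hlin.commute hAh j l
  have hreal : Commute (-K j) (-K l) := commute_of_commute_map hcomm
  exact Commute.neg_left_iff.1 (Commute.neg_right_iff.1 hreal)

/-! ### Strictly hyperbolic pencils: no uniform family, zeroth-order term included -/

/-- **A strictly hyperbolic pencil with `d, k ≥ 2` admits no uniform phase family in `M_p`,
`p ≠ 2`, zeroth-order term included** [Brenner1973, Thm 3.1, Cor 3.1]
(`false_of_localizedFamily_of_strictlyHyperbolic` applied to the pencil `-K`).
[cite: Brenner1973, Thm 3.1 and Cor 3.1 p. 84; Rauch1986, p. 481] -/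
theorem not_uniformPhaseFamily_of_strictlyHyperbolic_zeroth {p : ℝ≥0∞} (hp1 : 1 ≤ p)
    (hp2 : p ≠ 2) {K : Fin d → Matrix (Fin k) (Fin k) ℝ} (hK : IsStrictlyHyperbolicPencil K)
    (hd : 2 ≤ d) (hk : 2 ≤ k) {E : Matrix (Fin k) (Fin k) ℝ} (h : UniformPhaseFamily p K E) :
    False := by
  set K' : Fin d → Matrix (Fin k) (Fin k) ℝ := fun j => -K j with hK'
  have hK'h : IsStrictlyHyperbolicPencil K' := by
    have h1 := IsStrictlyHyperbolicPencil.smul (K := K) hK (c := -1) (by norm_num)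
    have heq : (fun j => (-1 : ℝ) • K j) = K' := funext fun j => by rw [hK', neg_one_smul]
    rwa [heq] at h1
  exact false_of_localizedFamily_of_strictlyHyperbolic hK'h hd hk hp1 hp2 (s := 1) one_ne_zero
    (E.map (algebraMap ℝ ℂ)) fun ξ₁ _ => localizedFamily_of_uniformPhaseFamily h ξ₁

/-! ### Brenner's criterion for Rauch's multiplier at a single time, zeroth-order term included -/

/-- **Rauch's appeal to Brenner, zeroth-order term included, at the single time `T`.** For a
constant-coefficient system `A₀∂ₜv + Σ Aⱼ∂ⱼv + B₁v = 0` in Rauch's class at `0` (symmetrizable,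
or `A₀` invertible and strictly hyperbolic) and `T > 0`: if Rauch's multiplier
`M_T = rauchSymbol A₀ A B₁ T = exp(-TA₀⁻¹(2πiΣξ_lA_l + B₁))` is an `Lᵖ` multiplier for some
`1 ≤ p ≤ ∞`, `p ≠ 2`, then the `A₀⁻¹Aⱼ` commute. This is the last sentence of
[Rauch1986, Proof of Theorem p. 483] ("(3) is a necessary … condition for `M` to be an `Lᵖ`
multiplier for some `1 < p < ∞`, `p ≠ 2`") for `M = exp(t̄A₀⁻¹(-Σ A_l iξ_l - B′(ū)))` with the
zeroth-order term `B′(ū)`, whose printed justification (Brenner's theorems) assumes either no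
lower-order term [Brenner1973, Cor 3.1 p. 84] or the multiplier bound for all `0 < t ≤ T`
[Brenner1973, (5.4) p. 92, Lemma 5.2 p. 97, Thm 5.1 p. 93]; here the lower-order term is removed
at the single time by first-order averaging of the dilates `M_T(n·) = exp(-inK - E)`
(`rauchSymbol_smul`, `commute_of_uniformPhaseFamily_symmetric_zeroth`,
`not_uniformPhaseFamily_of_strictlyHyperbolic_zeroth`). The case `B₁ = 0` is the tree's
`Rauch1986_LpMultiplier_forces_commutation_holds`.
[cite: Rauch1986, Proof of Theorem p. 483 (last sentence); Brenner1973, Cor 3.1 p. 84 and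
Thm 5.1 p. 93; BrennerThomeeWahlbin1975, Ch. 5 §1 Thm 1.1, Lemmas 1.1–1.2] -/
theorem commute_of_isLpMultiplier_rauchSymbol (A₀ : Matrix (Fin k) (Fin k) ℝ)
    (A : Fin d → Matrix (Fin k) (Fin k) ℝ) (B₁ : (Fin k → ℝ) →L[ℝ] (Fin k → ℝ))
    (hS : (ofConstant A₀ A B₁).IsRauchClass 0) {T : ℝ} (hT : 0 < T) {p : ℝ≥0∞} (hp1 : 1 ≤ p)
    (hp2 : p ≠ 2) (hM : IsLpMultiplier p (rauchSymbol A₀ A B₁ T)) (j l : Fin d) :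
    Commute (A₀⁻¹ * A j) (A₀⁻¹ * A l) := by
  -- the uniform phase family of the dilates, zeroth-order matrix `E = -TA₀⁻¹B₁`
  have hfam : UniformPhaseFamily p (rauchPencil A₀ A T) (rauchZeroth A₀ B₁ T) :=
    uniformPhaseFamily_of_isLpMultiplier_rauchSymbol hM
  obtain ⟨U, hU, hcases⟩ := hS.hyperbolic
  have h0U : (0 : Fin k → ℝ) ∈ U := mem_of_mem_nhds hU
  rcases hcases with ⟨Sym, -, hSym⟩ | hst
  · -- symmetrizable branch
    obtain ⟨hpos, hsymm⟩ := hSym 0 h0U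
    simp only [ofConstant_A0, ofConstant_A] at hpos hsymm
    obtain ⟨R, hR, K', hK', hconj⟩ := exists_conj_isSymm_rauchPencil A₀ A (Sym 0) hpos hsymm T
    have hR' : IsUnit (R⁻¹).det := Matrix.isUnit_nonsing_inv_det R hR
    have hfam' : UniformPhaseFamily p K' ((R⁻¹)⁻¹ * rauchZeroth A₀ B₁ T * R⁻¹) := by
      have h1 := hfam.conj (R⁻¹) hR'
      have hK'eq : (fun l => (R⁻¹)⁻¹ * rauchPencil A₀ A T l * R⁻¹) = K' := by
        funext l
        rw [hconj l, Matrix.nonsing_inv_nonsing_inv R hR]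
        have hRR' : R * R⁻¹ = 1 := Matrix.mul_nonsing_inv _ hR
        calc R * (R⁻¹ * K' l * R) * R⁻¹ = (R * R⁻¹) * K' l * (R * R⁻¹) := by
              simp only [Matrix.mul_assoc]
          _ = K' l := by rw [hRR', Matrix.one_mul, Matrix.mul_one]
      rwa [hK'eq] at h1
    have hcomm : Commute (K' j) (K' l) :=
      commute_of_uniformPhaseFamily_symmetric_zeroth hp1 hp2 hK' hfam' j l
    have hpen : Commute (rauchPencil A₀ A T j) (rauchPencil A₀ A T l) := by
      rw [hconj j, hconj l]
      exact commute_conj hR hcomm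
    exact commute_of_commute_rauchPencil hT.ne' hpen
  · -- strictly hyperbolic branch
    obtain ⟨-, hstrict⟩ := hst 0 h0U
    rcases Nat.lt_or_ge d 2 with hd | hd
    · have : Subsingleton (Fin d) := Fin.subsingleton_iff_le_one.2 (by omega)
      rw [Subsingleton.elim j l]
    rcases Nat.lt_or_ge k 2 with hk | hk
    · exact commute_of_le_one (by omega) _ _
    · exact (not_uniformPhaseFamily_of_strictlyHyperbolic_zeroth hp1 hp2
        (isStrictlyHyperbolicPencil_rauchPencil hstrict hT.ne') hd hk hfam).elim

/-! ### Consequences for Rauch's linear step and theorem -/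

/-- **Ingredient 1 with zeroth-order term**: Rauch's reduction "(5) ⟹ `M_T ∈ M_p`,
`1 < p ≤ 2`" for `M_T = rauchSymbol A₀ A B₁ T`, relative to the interpolation of homogeneous
Sobolev bounds (`gradientLpBound_interpolation`) and finite speed of propagation for Rauch's
class (`Rauch1986_finitePropagationSpeed`); the Riesz-transform step is the tree's
`isLpMultiplier_of_gradientLpBound_holds`. Same proof as
`Rauch1986_L1GradientEstimate_imp_LpMultiplier_of`, whose lemmas are stated for a general `B₁`.
[cite: Rauch1986, Proof of Theorem p. 483, (5)–(6)] -/
theorem isLpMultiplier_rauchSymbol_of_L1GradientEstimate (hI : gradientLpBound_interpolation)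
    (hF : Rauch1986_finitePropagationSpeed) (A₀ : Matrix (Fin k) (Fin k) ℝ)
    (A : Fin d → Matrix (Fin k) (Fin k) ℝ) (B₁ : (Fin k → ℝ) →L[ℝ] (Fin k → ℝ))
    (hS : (ofConstant A₀ A B₁).IsRauchClass 0) {c T : ℝ} (hc : 0 < c) (hT : 0 < T)
    (hyp : ∀ φ : Space d → Fin k → ℝ, ContDiff ℝ ∞ φ → HasCompactSupport φ →
      ∃ v : ℝ → Space d → Fin k → ℝ,
        (ofConstant A₀ A B₁).IsClassicalSolution T v ∧ (∀ x, v 0 x = φ x) ∧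
        HasCompactSupport (v T) ∧
        ∫ x, ‖fderiv ℝ (v T) x‖ ≤ c * ∫ x, ‖fderiv ℝ φ x‖)
    {p : ℝ≥0∞} (hp₁ : 1 < p) (hp₂ : p ≤ 2) : IsLpMultiplier p (rauchSymbol A₀ A B₁ T) := by
  obtain ⟨hdet, -⟩ := exists_continuous_symmetrizer_family hS
  obtain ⟨cₚ, hcₚ, hps⟩ := hF (ofConstant A₀ A B₁) 0 hS
  obtain ⟨C₀, hC₀⟩ := exists_nnreal_bound_rauchSymbol hS T
  have hM := measurable_rauchSymbol_apply A₀ A B₁ T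
  have hbdd : ∃ C : ℝ, ∀ (ξ : Space d) (a b : Fin k), ‖rauchSymbol A₀ A B₁ T ξ a b‖ ≤ C :=
    ⟨C₀, hC₀⟩
  rcases eq_or_lt_of_le hp₂ with rfl | hp₂'
  · exact isLpMultiplier_two_rauchSymbol hS T
  have h1 := hasGradientLpBoundWith_one_rauchSymbol hS hdet hcₚ hps hT.le hc.le hyp
  have h2 := hasGradientLpBoundWith_two_of_bounded hM hC₀
  obtain ⟨cp, hcp⟩ := hI (rauchSymbol A₀ A B₁ T) hM hbdd h1 h2 p hp₁ hp₂'
  exact isLpMultiplier_of_gradientLpBound_holds (rauchSymbol A₀ A B₁ T) hM hbdd p cp hp₁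
    (hp₂'.trans ENNReal.ofNat_lt_top) hcp

/-- **Rauch's linear step WITH zeroth-order term, `Rauch1986_linearL1EstimateForcesCommutation`,
relative to interpolation and finite speed of propagation only**: the `L¹` gradient estimate (5)
at the single time `T` makes `M_T ∈ M_{3/2}` (`isLpMultiplier_rauchSymbol_of_L1GradientEstimate`)
and Brenner's criterion with zeroth-order term at the single time
(`commute_of_isLpMultiplier_rauchSymbol`) gives the commutation relations (3). With this, the
passage of [Rauch1986, p. 483] from the single time `t̄` to the commutation relations in the
presence of `B′(ū) ≠ 0` (`NoBVEstimatesMultiD.lean`, `scope_caveats` (e)) is proved, and the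
named fact rests on the two classical inputs `gradientLpBound_interpolation` [Badr2009] and
`Rauch1986_finitePropagationSpeed` (open only for strictly hyperbolic systems with `d ≥ 2`,
`k ≥ 3`). [cite: Rauch1986, Theorem p. 482 (linear case) and Proof of Theorem p. 483] -/
theorem Rauch1986_linearL1EstimateForcesCommutation_of_interpolation
    (hI : gradientLpBound_interpolation) (hF : Rauch1986_finitePropagationSpeed) :
    Rauch1986_linearL1EstimateForcesCommutation := by
  intro d k A₀ A B₁ hS c T hc hT hyp j l
  have hp₁ : (1 : ℝ≥0∞) < (3 / 2 : ℝ≥0) := by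
    rw [← ENNReal.coe_one, ENNReal.coe_lt_coe]; norm_num
  have hp₂ : ((3 / 2 : ℝ≥0) : ℝ≥0∞) < 2 := by
    rw [show (2 : ℝ≥0∞) = ((2 : ℝ≥0) : ℝ≥0∞) from rfl, ENNReal.coe_lt_coe]; norm_num
  have hMp : IsLpMultiplier ((3 / 2 : ℝ≥0) : ℝ≥0∞) (rauchSymbol A₀ A B₁ T) :=
    isLpMultiplier_rauchSymbol_of_L1GradientEstimate hI hF A₀ A B₁ hS hc hT hyp hp₁ hp₂.le
  exact commute_of_isLpMultiplier_rauchSymbol A₀ A B₁ hS hT hp₁.le hp₂.ne hMp j l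

/-- **Rauch's theorem `NoBVEstimatesMultiDBarrier` (zeroth-order term `B` with `B(ū) = 0`,
`B′(ū)` arbitrary) relative to its three classical inputs**: the `L²` small-amplitude expansion
(`Rauch1986_smallAmplitudeExpansionL2`: `Hˢ` local well-posedness of quasilinear symmetrizable /
strictly hyperbolic systems), finite speed of propagation for Rauch's class
(`Rauch1986_finitePropagationSpeed`), and the interpolation of homogeneous Sobolev bounds
(`gradientLpBound_interpolation`) — every other step of the printed proof, including the
single-time appeal to Brenner with `B′(ū) ≠ 0`, being proved in the tree.
[cite: Rauch1986, Theorem p. 482 and Proof of Theorem pp. 482–483] -/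
theorem NoBVEstimatesMultiDBarrier_of_expansion_propagation_interpolation
    (hE : Rauch1986_smallAmplitudeExpansionL2) (hF : Rauch1986_finitePropagationSpeed)
    (hI : gradientLpBound_interpolation) : NoBVEstimatesMultiDBarrier :=
  NoBVEstimatesMultiDBarrier_of_residualFacts hE hF
    (Rauch1986_linearL1EstimateForcesCommutation_of_interpolation hI hF)

end Literature.Barriers.AtomisticToContinuum

end
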